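import Literature.Computability.QuantumComplexity.LightCone
import Literature.Computability.QuantumComplexity.CircuitEmbedding
import Literature.Computability.QuantumComplexity.PauliBlocks
import Literature.Computability.QuantumComplexity.TruncationRescaling
import HarnessLib

/-!
# Average values see only the past light cone; exact evaluation in the register of the cone's wires

Topic `Literature/Computability/QuantumComplexity`; sequel of `LightCone.lean` (`LightCone.cone gs S`:
the backward light cone of the wire set `S` through the gate list `gs`; `SupportedOn S M`: `M`
commutes with every gate placed off `S`; `acceptProb_eq_acceptProb_cone`: the acceptance
probability of a circuit over a unitary gate set is that of the cone of the measured wire) and of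
`CircuitEmbedding.lean` (`mapWiresGate e` / `mapWires e`: transport of gates along a wire embedding,
`toMatrix_mapWires : U(transported) = placeGate e U`). That file treats the MEASURED WIRE; this one
treats the AVERAGE VALUE `⟨ψ|U† O U|ψ⟩` of an arbitrary observable `O` supported on `S`
(`obsForm` of `TruncationRescaling.lean`, `braket` of `TruncatedStateFidelity.lean`), which is the
form in which light cones are used to evaluate local observables of shallow circuits exactly on
few qubits (pub-qadeq lane, CLAIMS E-21 / S-6: early-time values of `⟨Zⱼ Z_k⟩` of a 56-qubit
Floquet circuit from ≤ 24-qubit patches; HONEST FRAMING: instance-level adjudication of specific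
advantage claims; no claim about BQP vs BPP or the summit — this file is the textbook linear
algebra such an evaluation rests on, and says nothing about any experiment or any simulation cost).

## Contents (all proved; no named facts)

* `heis A gs O = U(gs)† O U(gs)` — the Heisenberg picture of `O` through the gate list `gs`;
  `heis_nil`, `heis_cons`; `SupportedOn.conjTranspose`, `supportedOn_heis` (through gates inside
  `T`, an observable supported on `T` stays supported on `T`).
* **`heis_eq_heis_cone`** — over a unitary gate set, `U(gs)† O U(gs) = U(cone)† O U(cone)` for `O`
  supported on `S`, `cone = (cone gs S).2`: an OPERATOR identity (a gate off the current cone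
  commutes with the cone's Heisenberg observable and `g† g = 1`); `obsForm_mulVec_mulVec`
  (`⟨Uψ|O|Uψ⟩ = ⟨ψ|U†OU|ψ⟩`), `obsForm_toMatrix_mulVec`, and **`obsForm_toMatrix_eq_cone`** — the
  average value of `O` after `gs` in ANY input state equals that after the cone's gates.
* `sepState e a b = a ⊗ b` — a product state across the bipartition (wires of the block
  `e : Fin k ↪ Fin N` | the other wires `Off e`), either factor arbitrary; `placeGate_mulVec_sepState`
  (frame rule `(M ⊗ 1)(a ⊗ b) = Ma ⊗ b`), `braket_sepState_sepState` (`⟨a⊗b|a'⊗b'⟩ = ⟨a|a'⟩⟨b|b'⟩`),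
  `obsForm_placeGate_sepState` (`⟨a⊗b|M⊗1|a⊗b⟩ = ⟨a|M|a⟩⟨b|b⟩`); for products of single-qubit states
  `z ↦ ∏_w u_w(z_w)` (the tree's `productVec u`, `SeparableCone.lean`, definitionally):
  `braket_pi_pi` (`⟨⊗u|⊗v⟩ = ∏⟨u_w|v_w⟩`), `pi_eq_sepState` (`⊗_w u_w = (⊗_j u_{e j}) ⊗ (⊗_{off} u)`),
  and **`obsForm_mapWires_pi`** — the `N`-qubit average value of `O' ⊗ 1` after `U ⊗ 1` on `⊗_w u_w`
  (unit factors off the block) is the `k`-qubit average value of `O'` after `U` on `⊗_j u_{e j}`.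
* `exists_map_mapWiresGate_eq` / `exists_map_mapWiresGate_eq_cone` — a gate list (in particular
  the cone's) acting inside the block `e` is the transport along `e` of a `k`-qubit gate list.
* **`obsForm_toMatrix_pi_eq_patch`** — the assembled statement: for `O' ⊗ 1` supported on `S`, a
  product input with unit factors off the block, and a cone transported from `gs'` on the block,
  `⟨O' ⊗ 1⟩ after gs on ⊗_w u_w = ⟨O'⟩ after gs' on ⊗_j u_{e j}` — exact, no truncation.

* Block coordinates (`splitFun e Bool` of `PauliBlocks.lean`; `reindex_placeGate`: `placeGate e X`
  is `X ⊗ₖ 1`): `obsForm_reindex` (average values are invariant under relabelling),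
  `pi_comp_splitFun_symm`, `braket_pair`, `kronecker_mulVec_pair`, `obsForm_kronecker_pair`
  (`⟨a⊗b|X⊗Y|a⊗b⟩ = ⟨a|X|a⟩⟨b|Y|b⟩`), `exists_reindex_placeGate_eq_one_kronecker` (a gate placed on
  wires DISJOINT from the block is `1 ⊗ₖ Y₀` in block coordinates), and
  **`obsForm_placeGate_mul_placeGate_pi`**: on a product of single-qubit unit vectors, observables
  placed on disjoint blocks factorise, `⟨(X⊗1)(1⊗Y)⟩ = ⟨X⊗1⟩⟨1⊗Y⟩`.
* `heis_mul` (`U†(OO')U = (U†OU)(U†O'U)`), `heis_map_mapWiresGate` (`heis` through transported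
  gates of `O'⊗1` is `(U'†O'U') ⊗ 1`), and **`obsForm_toMatrix_mul_eq_mul_of_disjoint`**: after a
  circuit over a unitary gate set, two block observables whose backward light cones are transports
  of gate lists on DISJOINT blocks have `⟨O₁ O₂⟩ = ⟨O₁⟩⟨O₂⟩` on a product input (Bravyi–Gosset–
  Movassagh: “since the lightcones of `S₁` and `S₂` do not overlap, `μ_S` is a product”).

## What is NOT here

Any counting of the cone's wires for a given lattice and depth (`card_cone_le` of `LightCone.lean`
is the one-dimensional `q`-local bound); nothing about tensor-network contraction cost; no
statement about any particular circuit or experiment.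

## References

* M. A. Nielsen, I. L. Chuang, *Quantum Computation and Quantum Information*, CUP 2010, §2.1.6
  eq. (2.32) (adjoint), §2.1.7 eqs. (2.45), (2.49), (2.53) (tensor products of operators, of inner
  products, of adjoints), §2.2.5 (average value `⟨ψ|M|ψ⟩`), §4.2–§4.3 (circuits; a gate on a
  subset of the wires acts as `U ⊗ 1`; gates after or outside the causal past of an observable do
  not affect its statistics) [NielsenChuang2010].
* S. Bravyi, D. Gosset, R. Movassagh, *Classical algorithms for quantum mean values*, Nature Physics
  17 (2021) 337–341 = arXiv:1909.11485 [BravyiGossetMovassagh2021]: §2 Definition 1 (“The (forward)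
  lightcone of a qubit `j` … is the smallest subset of qubits `𝓛(j)` such that `j ∈ 𝓛(j)` and
  `U† 𝒜_j U ⊆ 𝒜_{𝓛(j)}` … Therefore, for any `S ⊂ [n]`, the unitary `U` maps any operator acting on `S`
  to an operator supported on `𝓛(S)`”), §1 eq. (2) (`μ = ⟨0ⁿ|U† O U|0ⁿ⟩`), §3, proof of Theorem 1
  (“`μ_S(ε) ≡ ⟨0ⁿ|U† ∏_{j∈S} O_j(ε) U|0ⁿ⟩` … one can first restrict the circuit `U` by removing any
  gate which acts outside of `𝓛(S)`. The latter contains at most `ℓ₁|S|` qubits. The restricted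
  circuit can be simulated by the brute-force method in time `2^{O(ℓ₁|S|)}`”), §3, proof of
  Lemma 3 (“Since the lightcones of `S₁` and `S₂` do not overlap, `μ_S(ε)` is a product of some
  polynomial depending on `{ε_j : j ∈ S₁}` and some polynomial depending on `{ε_j : j ∈ S₂}`”). The present file
  proves these sentences in the tree's circuit model, with the backward light cone `LightCone.cone`
  (a gate-list scan) in the role of `𝓛(S)` and product inputs in the role of `|0ⁿ⟩`.
* I. L. Markov, Y. Shi, *Simulating quantum computation by contracting tensor networks*, SIAM J.
  Comput. 38 (2008) 963–981, §5 (light cones of shallow circuits; the setting of `LightCone.lean`).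
-/

noncomputable section

namespace Literature.Computability.QuantumComplexity

open _root_.Computability Cryptography Matrix
open scoped ComplexConjugate

namespace LightCone

variable {G : QGateSet} {N : ℕ}

/-! ### The Heisenberg picture of a gate list -/

/-- **The Heisenberg-picture observable** `U(gs)† · O · U(gs)` of the observable `O` after the gate
list `gs` (head = first gate to act), relative to the oracle `A`: the operator whose average value
in the INPUT state is the average value of `O` in the output state (the map `𝒜_S ∋ O ↦ U† O U` of the
lightcone definition). [cite: BravyiGossetMovassagh2021, §2 Definition 1] -/
def heis (A : Language Bool) (gs : List (QGate G N)) (O : Matrix (QReg N) (QReg N) ℂ) :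
    Matrix (QReg N) (QReg N) ℂ :=
  ((⟨gs⟩ : QCircuit G N).toMatrix A)ᴴ * O * (⟨gs⟩ : QCircuit G N).toMatrix A

/-- No gates: the Heisenberg picture of `O` is `O` (`U = 1`). [cite: BravyiGossetMovassagh2021, §2 Definition 1] -/
@[simp] theorem heis_nil (A : Language Bool) (O : Matrix (QReg N) (QReg N) ℂ) :
    heis A ([] : List (QGate G N)) O = O := by
  simp [heis]

/-- One more (first) gate `g`: `U(g :: gs)† O U(g :: gs) = g† · (U(gs)† O U(gs)) · g`.
[cite: NielsenChuang2010, §2.1.6 (after eq. (2.32): (AB)† = B†A†)] -/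
theorem heis_cons (A : Language Bool) (g : QGate G N) (gs : List (QGate G N))
    (O : Matrix (QReg N) (QReg N) ℂ) :
    heis A (g :: gs) O = (g.toMatrix A)ᴴ * heis A gs O * g.toMatrix A := by
  simp only [heis, QCircuit.toMatrix_cons, Matrix.conjTranspose_mul, Matrix.mul_assoc]

/-- The adjoint of an operator supported on `S` is supported on `S` (the adjoint of a gate placed
off `S` is a gate placed off `S`). [cite: NielsenChuang2010, §2.1.7 eq. (2.53)] -/
theorem SupportedOn.conjTranspose {S : Finset (Fin N)} {M : Matrix (QReg N) (QReg N) ℂ}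
    (h : SupportedOn S M) : SupportedOn S Mᴴ := by
  intro k e U he
  have h' := h e Uᴴ he
  have := congrArg Matrix.conjTranspose h'
  rw [Matrix.conjTranspose_mul, Matrix.conjTranspose_mul, conjTranspose_placeGate,
    Matrix.conjTranspose_conjTranspose] at this
  exact this.symm

/-- The Heisenberg picture, through gates acting inside `T`, of an observable supported on `T`
is supported on `T` — “the unitary `U` maps any operator acting on `S` to an operator supported on
`𝓛(S)`”. [cite: BravyiGossetMovassagh2021, §2 Definition 1] -/
theorem supportedOn_heis (A : Language Bool) {T : Finset (Fin N)} {O : Matrix (QReg N) (QReg N) ℂ}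
    (hO : SupportedOn T O) :
    ∀ {gs : List (QGate G N)}, (∀ g ∈ gs, g.wires ⊆ T) → SupportedOn T (heis A gs O)
  | [], _ => by rw [heis_nil]; exact hO
  | g :: gs, h => by
    rw [heis_cons]
    have hg : SupportedOn T (g.toMatrix A) := supportedOn_toMatrix A (h g List.mem_cons_self)
    exact (hg.conjTranspose.mul
      (supportedOn_heis A hO fun g' hg' => h g' (List.mem_cons_of_mem g hg'))).mul hg

/-- **Operators see only their past light cone (Heisenberg picture).** Over a unitary gate set,
for an observable `O` supported on the wire set `S`:
`U(gs)† O U(gs) = U(cone)† O U(cone)`, where `cone = (cone gs S).2` is the list of gates in the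
backward light cone of `S`. Scanning from the last gate: a gate `g` off the current cone commutes
with `U(cone)† O U(cone)` (supported on the cone) and `g† g = 1`: “one can first restrict the
circuit `U` by removing any gate which acts outside of `𝓛(S)`”.
[cite: BravyiGossetMovassagh2021, §3 (proof of Theorem 1, computation of μ_S)] -/
theorem heis_eq_heis_cone (hG : G.IsUnitary) (A : Language Bool) {S : Finset (Fin N)}
    {O : Matrix (QReg N) (QReg N) ℂ} (hO : SupportedOn S O) :
    ∀ gs : List (QGate G N), heis A gs O = heis A (cone gs S).2 O
  | [] => rfl
  | g :: gs => by
    rw [heis_cons, heis_eq_heis_cone hG A hO gs]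
    by_cases h : Disjoint g.wires (cone gs S).1
    · -- the gate is dropped: it commutes with the cone's Heisenberg observable, and `g† g = 1`
      rw [cone_cons_of_disjoint h]
      have hsupp : SupportedOn (cone gs S).1 (heis A (cone gs S).2 O) :=
        supportedOn_heis A (hO.mono (subset_cone gs S)) (wires_subset_cone gs S)
      have hU := QGate.toMatrix_mem_unitaryGroup_holds hG A g
      rw [Matrix.mul_assoc, hsupp.comm_toMatrix A h, ← Matrix.mul_assoc, ← star_eq_conjTranspose,
        Matrix.mem_unitaryGroup_iff'.1 hU, Matrix.one_mul]
    · -- the gate is kept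
      rw [cone_cons_of_not_disjoint h]
      simp only
      rw [heis_cons]

/-! ### Average values -/

/-- The tree's `braket u v = Σ conj(uᵢ) vᵢ` is Mathlib's `star u ⬝ᵥ v` (plumbing). [folklore] -/
private theorem braket_eq_star_dotProduct (u v : QReg N → ℂ) : braket u v = star u ⬝ᵥ v := by
  simp [braket, dotProduct, Pi.star_apply]

/-- **Schrödinger = Heisenberg for average values**: `⟨Uψ|O|Uψ⟩ = ⟨ψ|U† O U|ψ⟩` (any matrix `U`).
[cite: NielsenChuang2010, §2.1.6 eq. (2.32)] -/
theorem obsForm_mulVec_mulVec (O U : Matrix (QReg N) (QReg N) ℂ) (ψ : QReg N → ℂ) :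
    obsForm O (U *ᵥ ψ) (U *ᵥ ψ) = obsForm (Uᴴ * O * U) ψ ψ := by
  rw [obsForm, obsForm, braket_eq_star_dotProduct, braket_eq_star_dotProduct, Matrix.star_mulVec,
    ← Matrix.dotProduct_mulVec, Matrix.mulVec_mulVec, Matrix.mulVec_mulVec]

/-- The average value of `O` after the gate list `gs` is the average value of its Heisenberg
picture in the input state (`μ = ⟨0ⁿ|U† O U|0ⁿ⟩`). [cite: BravyiGossetMovassagh2021, §1 eq. (2)] -/
theorem obsForm_toMatrix_mulVec (A : Language Bool) (gs : List (QGate G N))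
    (O : Matrix (QReg N) (QReg N) ℂ) (ψ : QReg N → ℂ) :
    obsForm O ((⟨gs⟩ : QCircuit G N).toMatrix A *ᵥ ψ) ((⟨gs⟩ : QCircuit G N).toMatrix A *ᵥ ψ) =
      obsForm (heis A gs O) ψ ψ :=
  obsForm_mulVec_mulVec O _ ψ

/-- **Average values see only the past light cone.** Over a unitary gate set, for an observable
`O` supported on `S` and ANY input state `ψ`: the average value of `O` after the circuit `gs`
equals its average value after the sub-circuit of the gates in the backward light cone of `S`.
“Each mean value `μ_S` can be computed by restricting the circuit `U` onto the lightcone of `S`.”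
[cite: BravyiGossetMovassagh2021, §3 (proof of Theorem 1, computation of μ_S)] -/
theorem obsForm_toMatrix_eq_cone (hG : G.IsUnitary) (A : Language Bool) {S : Finset (Fin N)}
    {O : Matrix (QReg N) (QReg N) ℂ} (hO : SupportedOn S O) (gs : List (QGate G N))
    (ψ : QReg N → ℂ) :
    obsForm O ((⟨gs⟩ : QCircuit G N).toMatrix A *ᵥ ψ) ((⟨gs⟩ : QCircuit G N).toMatrix A *ᵥ ψ) =
      obsForm O ((⟨(cone gs S).2⟩ : QCircuit G N).toMatrix A *ᵥ ψ)
        ((⟨(cone gs S).2⟩ : QCircuit G N).toMatrix A *ᵥ ψ) := by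
  rw [obsForm_toMatrix_mulVec, obsForm_toMatrix_mulVec, heis_eq_heis_cone hG A hO]


/-! ### Product states across a block of wires, and evaluation in the block's own register -/

section Block

open scoped Classical

variable {k : ℕ}

/-- **A product state across the bipartition (wires of `e` | the other wires)**:
`(a ⊗ b)(z) = a(z ∘ e) · b(z|_{off e})`, for an amplitude vector `a` of the `k`-qubit block placed
along `e : Fin k ↪ Fin N` and an amplitude vector `b` of the remaining wires `Off e`. Either
factor may be entangled internally (the state `|v⟩ ⊗ |w⟩` in Kronecker coordinates).
[cite: NielsenChuang2010, §2.1.7 eq. (2.50)] -/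
def sepState (e : Fin k ↪ Fin N) (a : QReg k → ℂ) (b : (Off e → Bool) → ℂ) : QReg N → ℂ :=
  fun z => a (z ∘ e) * b (fun l => z l)

/-- The amplitudes of `sepState` (definitional; the coordinates of `|v⟩ ⊗ |w⟩`).
[cite: NielsenChuang2010, §2.1.7 eq. (2.50)] -/
theorem sepState_apply (e : Fin k ↪ Fin N) (a : QReg k → ℂ) (b : (Off e → Bool) → ℂ) (z : QReg N) :
    sepState e a b z = a (z ∘ e) * b (fun l => z l) := rfl

/-- `sepState` read through the wire splitting `splitWires e : QReg N ≃ QReg k × (Off e → Bool)`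
(the Kronecker coordinates of `|v⟩ ⊗ |w⟩`). [cite: NielsenChuang2010, §2.1.7 eq. (2.50)] -/
theorem sepState_eq_splitWires (e : Fin k ↪ Fin N) (a : QReg k → ℂ) (b : (Off e → Bool) → ℂ)
    (z : QReg N) : sepState e a b z = a (splitWires e z).1 * b (splitWires e z).2 := by
  have h2 : (fun l : Off e => z l) = (splitWires e z).2 := funext fun l => (splitWires_snd e z l).symm
  rw [sepState_apply, splitWires_fst, h2]

/-- **Frame rule** `(M ⊗ 1)(a ⊗ b) = (M a) ⊗ b`: an operator placed on the block acts on the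
block factor only. [cite: NielsenChuang2010, §2.1.7 eq. (2.45)] -/
theorem placeGate_mulVec_sepState (e : Fin k ↪ Fin N) (M : Matrix (QReg k) (QReg k) ℂ)
    (a : QReg k → ℂ) (b : (Off e → Bool) → ℂ) :
    placeGate e M *ᵥ sepState e a b = sepState e (M *ᵥ a) b := by
  funext x
  rw [placeGate_mulVec_apply, sepState_apply, Matrix.mulVec, dotProduct, Finset.sum_mul]
  refine Finset.sum_congr rfl fun z _ => ?_
  rw [sepState_apply, extend_comp_embedding]
  have hb : (fun l : Off e => Function.extend e z x l) = fun l : Off e => x l :=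
    funext fun l => extend_apply_of_not_mem e z x l.2
  rw [hb, mul_assoc]

/-- **The inner product factorises on product states**: `⟨a ⊗ b | a' ⊗ b'⟩ = ⟨a|a'⟩ ⟨b|b'⟩`.
[cite: NielsenChuang2010, §2.1.7 eq. (2.49)] -/
theorem braket_sepState_sepState (e : Fin k ↪ Fin N) (a a' : QReg k → ℂ) (b b' : (Off e → Bool) → ℂ) :
    braket (sepState e a b) (sepState e a' b') = braket a a' * braket b b' := by
  unfold braket
  rw [← Equiv.sum_comp (splitWires e).symm, Fintype.sum_prod_type, Finset.sum_mul_sum]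
  refine Finset.sum_congr rfl fun p _ => Finset.sum_congr rfl fun r _ => ?_
  rw [sepState_eq_splitWires, sepState_eq_splitWires, Equiv.apply_symm_apply, map_mul]
  ring

/-- **Average value of a block observable in a product state**:
`⟨a ⊗ b| M ⊗ 1 |a ⊗ b⟩ = ⟨a|M|a⟩ · ⟨b|b⟩`. [cite: NielsenChuang2010, §2.1.7 eqs. (2.45), (2.49)] -/
theorem obsForm_placeGate_sepState (e : Fin k ↪ Fin N) (M : Matrix (QReg k) (QReg k) ℂ)
    (a : QReg k → ℂ) (b : (Off e → Bool) → ℂ) :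
    obsForm (placeGate e M) (sepState e a b) (sepState e a b) = obsForm M a a * braket b b := by
  rw [obsForm, placeGate_mulVec_sepState, braket_sepState_sepState, obsForm]

/-! ### Single-qubit product states -/

/-- **Inner product of products of single-qubit states**: for index-wise factors `u l, v l : Bool → ℂ`,
`⟨⊗ₗ uₗ | ⊗ₗ vₗ⟩ = ∏ₗ ⟨uₗ|vₗ⟩`. [cite: NielsenChuang2010, §2.1.7 eq. (2.49)] -/
theorem braket_pi_pi {L : Type*} [Fintype L] [DecidableEq L] (u v : L → Bool → ℂ) :
    braket (fun r : L → Bool => ∏ l, u l (r l)) (fun r => ∏ l, v l (r l)) = ∏ l, braket (u l) (v l) := by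
  unfold braket
  simp_rw [map_prod, ← Finset.prod_mul_distrib]
  exact (Fintype.prod_sum fun l c => conj (u l c) * v l c).symm

/-- **A product of single-qubit states is a product state across every block**:
`⊗_w u_w = (⊗_j u_{e j}) ⊗ (⊗_{l ∉ e} u_l)` (the tree's `productVec`, `SeparableCone.lean`, is the
left-hand side for `L = Fin N`; stated here for the defining product so that no further import is
needed). [cite: NielsenChuang2010, §2.1.7 eq. (2.50) and the notation |ψ⟩^⊗k] -/
theorem pi_eq_sepState (e : Fin k ↪ Fin N) (u : Fin N → Bool → ℂ) :
    (fun z : QReg N => ∏ w, u w (z w)) =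
      sepState e (fun p => ∏ j, u (e j) (p j)) (fun r => ∏ l : Off e, u l (r l)) := by
  funext z
  rw [sepState_apply, prod_eq_prod_block_mul_prod_off (e := e) (fun w => u w (z w))]
  rfl

/-- **Evaluation in the block's own register.** For a gate list `gs'` on `k` wires transported
along `e` (`mapWiresGate e`, i.e. `U ↦ U ⊗ 1`), an observable `O' ⊗ 1` placed along `e`, and a
product of single-qubit states `⊗_w u_w` whose factors OFF the block are unit vectors:
`⟨O' ⊗ 1⟩ after U ⊗ 1 on ⊗_w u_w  =  ⟨O'⟩ after U on ⊗_j u_{e j}` — the `N`-qubit average value is a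
`k`-qubit computation: “The restricted circuit can be simulated by the brute-force method in time
`2^{O(ℓ₁|S|)}`” (the lightcone `𝓛(S)` “contains at most `ℓ₁|S|` qubits”).
[cite: BravyiGossetMovassagh2021, §3 (proof of Theorem 1, computation of μ_S)] -/
theorem obsForm_mapWires_pi (A : Language Bool) (e : Fin k ↪ Fin N) (gs' : List (QGate G k))
    (O' : Matrix (QReg k) (QReg k) ℂ) (u : Fin N → Bool → ℂ)
    (hu : ∀ w, w ∉ Set.range e → braket (u w) (u w) = 1) :
    obsForm (placeGate e O')
        ((⟨gs'.map (mapWiresGate e)⟩ : QCircuit G N).toMatrix A *ᵥ fun z => ∏ w, u w (z w))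
        ((⟨gs'.map (mapWiresGate e)⟩ : QCircuit G N).toMatrix A *ᵥ fun z => ∏ w, u w (z w)) =
      obsForm O' ((⟨gs'⟩ : QCircuit G k).toMatrix A *ᵥ fun p => ∏ j, u (e j) (p j))
        ((⟨gs'⟩ : QCircuit G k).toMatrix A *ᵥ fun p => ∏ j, u (e j) (p j)) := by
  have hm : (⟨gs'.map (mapWiresGate e)⟩ : QCircuit G N).toMatrix A =
      placeGate e ((⟨gs'⟩ : QCircuit G k).toMatrix A) := toMatrix_mapWires e A ⟨gs'⟩
  have hheis : heis A (gs'.map (mapWiresGate e)) (placeGate e O') = placeGate e (heis A gs' O') := by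
    rw [heis, heis, hm, conjTranspose_placeGate, ← placeGate_mul_holds, ← placeGate_mul_holds]
  have hoff : braket (fun r : Off e → Bool => ∏ l : Off e, u l (r l)) (fun r => ∏ l : Off e, u l (r l)) = 1 := by
    rw [braket_pi_pi]
    exact Finset.prod_eq_one fun l _ => hu l l.2
  rw [obsForm_toMatrix_mulVec, obsForm_toMatrix_mulVec, hheis, pi_eq_sepState e u,
    obsForm_placeGate_sepState, hoff, mul_one]

end Block


/-! ### Pulling the cone back to the register of a block containing it -/

section Pullback

variable {k : ℕ}

/-- A wire embedding whose range lies inside the block `e` factors through `e` (plumbing). [folklore] -/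
private theorem exists_trans_eq_of_range_subset (e : Fin k ↪ Fin N) {a : ℕ} (f : Fin a ↪ Fin N)
    (h : ∀ j, f j ∈ Set.range e) : ∃ f' : Fin a ↪ Fin k, f'.trans e = f := by
  classical
  refine ⟨⟨fun j => (Equiv.ofInjective e e.injective).symm ⟨f j, h j⟩, fun j j' hjj' => ?_⟩, ?_⟩
  · have := congrArg (fun i : Fin k => (e i : Fin N)) hjj'
    simp only [Equiv.apply_ofInjective_symm e.injective] at this
    exact f.injective this
  · ext j
    simp [Function.Embedding.trans_apply, Equiv.apply_ofInjective_symm e.injective]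

/-- A gate acting inside the block `e` is the transport along `e` (`U ↦ U ⊗ 1`) of a gate of the
block's own register. [cite: NielsenChuang2010, §4.3 (a gate on a subset of the wires acts as U ⊗ 1)] -/
theorem exists_mapWiresGate_eq (e : Fin k ↪ Fin N) (g : QGate G N)
    (h : ∀ w ∈ g.wires, w ∈ Set.range e) : ∃ g' : QGate G k, mapWiresGate e g' = g := by
  cases g with
  | gate g f =>
    obtain ⟨f', hf'⟩ := exists_trans_eq_of_range_subset e f
      fun j => h (f j) ((mem_wires_gate_iff g f (f j)).2 ⟨j, rfl⟩)
    exact ⟨QGate.gate g f', by rw [mapWiresGate, hf']⟩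
  | oracle m f =>
    obtain ⟨f', hf'⟩ := exists_trans_eq_of_range_subset e f
      fun j => h (f j) ((mem_wires_oracle_iff m f (f j)).2 ⟨j, rfl⟩)
    exact ⟨QGate.oracle m f', by rw [mapWiresGate, hf']⟩

/-- **A gate list acting inside the block `e` is the transport along `e` of a gate list of the
block's own `k`-qubit register.** [cite: NielsenChuang2010, §4.3 (a gate on a subset of the wires acts as U ⊗ 1)] -/
theorem exists_map_mapWiresGate_eq (e : Fin k ↪ Fin N) :
    ∀ gs : List (QGate G N), (∀ g ∈ gs, ∀ w ∈ g.wires, w ∈ Set.range e) →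
      ∃ gs' : List (QGate G k), gs'.map (mapWiresGate e) = gs
  | [], _ => ⟨[], rfl⟩
  | g :: gs, h => by
    obtain ⟨g', hg'⟩ := exists_mapWiresGate_eq e g (h g List.mem_cons_self)
    obtain ⟨gs', hgs'⟩ := exists_map_mapWiresGate_eq e gs fun g'' hg'' => h g'' (List.mem_cons_of_mem g hg'')
    exact ⟨g' :: gs', by rw [List.map_cons, hg', hgs']⟩

/-- **The light cone lives in the register of any block containing its wires**: if the wires of
the backward light cone of `S` all lie in the block `e`, its gates are the transport along `e` of
a gate list on `k` qubits (“restrict the circuit `U` by removing any gate which acts outside of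
`𝓛(S)`. The latter contains at most `ℓ₁|S|` qubits.”).
[cite: BravyiGossetMovassagh2021, §3 (proof of Theorem 1, computation of μ_S)] -/
theorem exists_map_mapWiresGate_eq_cone (e : Fin k ↪ Fin N) (gs : List (QGate G N))
    (S : Finset (Fin N)) (h : ∀ w ∈ (cone gs S).1, w ∈ Set.range e) :
    ∃ gs' : List (QGate G k), gs'.map (mapWiresGate e) = (cone gs S).2 :=
  exists_map_mapWiresGate_eq e _ fun g hg w hw => h w (wires_subset_cone gs S g hg hw)

end Pullback

/-! ### The light-cone patch evaluation of a local average value is exact -/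

section Patch

open scoped Classical

variable {k : ℕ}

/-- **Exactness of the light-cone patch evaluation.** Over a unitary gate set, let the circuit
`gs` act on the product of single-qubit states `⊗_w u_w` (unit factors off the block `e`), and
let `O' ⊗ 1`, placed along the block `e : Fin k ↪ Fin N`, be supported on `S` (e.g. `Zⱼ Z_k`
with `S = {j, k}`). If the gates of the backward light cone of `S` are the transport along `e` of
a `k`-qubit gate list `gs'` (which is the case as soon as the cone's wires lie in the block,
`exists_map_mapWiresGate_eq_cone`), then the `N`-qubit average value of `O' ⊗ 1` after `gs`
EQUALS the `k`-qubit average value of `O'` after `gs'` on `⊗_j u_{e j}`: the gates outside the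
cone cancel against their adjoints (`heis_eq_heis_cone`) and the wires outside the block
contribute `∏ ⟨u_w|u_w⟩ = 1` (`obsForm_mapWires_pi`). No truncation, no approximation.
This is the sentence “one can first restrict the circuit `U` by removing any gate which acts outside
of `𝓛(S)`. The latter contains at most `ℓ₁|S|` qubits. The restricted circuit can be simulated by the
brute-force method” made a theorem for product inputs.
[cite: BravyiGossetMovassagh2021, §3 (proof of Theorem 1, computation of μ_S)] -/
theorem obsForm_toMatrix_pi_eq_patch (hG : G.IsUnitary) (A : Language Bool) {S : Finset (Fin N)}
    (e : Fin k ↪ Fin N) (O' : Matrix (QReg k) (QReg k) ℂ) (hO : SupportedOn S (placeGate e O'))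
    (gs : List (QGate G N)) (gs' : List (QGate G k))
    (hcone : (cone gs S).2 = gs'.map (mapWiresGate e)) (u : Fin N → Bool → ℂ)
    (hu : ∀ w, w ∉ Set.range e → braket (u w) (u w) = 1) :
    obsForm (placeGate e O')
        ((⟨gs⟩ : QCircuit G N).toMatrix A *ᵥ fun z => ∏ w, u w (z w))
        ((⟨gs⟩ : QCircuit G N).toMatrix A *ᵥ fun z => ∏ w, u w (z w)) =
      obsForm O' ((⟨gs'⟩ : QCircuit G k).toMatrix A *ᵥ fun p => ∏ j, u (e j) (p j))
        ((⟨gs'⟩ : QCircuit G k).toMatrix A *ᵥ fun p => ∏ j, u (e j) (p j)) := by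
  rw [obsForm_toMatrix_eq_cone hG A hO, hcone]
  exact obsForm_mapWires_pi A e gs' O' u hu

end Patch


/-! ### Block coordinates: disjointly placed observables factorise on product states -/

section Factorise

open scoped Classical Kronecker

variable {k k' : ℕ}

/-- Average values are invariant under relabelling the basis (transport of `O` and `ψ` along an
equivalence of index types). [cite: NielsenChuang2010, §2.1.7 eq. (2.50)] -/
theorem obsForm_reindex {α : Type*} [Fintype α] (σ : QReg N ≃ α) (M : Matrix (QReg N) (QReg N) ℂ)
    (v : QReg N → ℂ) :
    obsForm (reindex σ σ M) (v ∘ σ.symm) (v ∘ σ.symm) = obsForm M v v := by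
  rw [obsForm_eq_sum, obsForm_eq_sum]
  rw [← Equiv.sum_comp σ.symm]
  refine Finset.sum_congr rfl fun q _ => ?_
  rw [← Equiv.sum_comp σ.symm]
  rfl

/-- In block coordinates the product of single-qubit states `⊗_w u_w` is the pair product
`(⊗_j u_{e j}) ⊗ (⊗_{l ∉ e} u_l)`. [cite: NielsenChuang2010, §2.1.7 eq. (2.50)] -/
theorem pi_comp_splitFun_symm (e : Fin k ↪ Fin N) (u : Fin N → Bool → ℂ) :
    ((fun z : QReg N => ∏ w, u w (z w)) ∘ (splitFun e Bool).symm) =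
      fun q => (∏ j, u (e j) (q.1 j)) * ∏ l : Off e, u l (q.2 l) := by
  funext q
  obtain ⟨p, r⟩ := q
  rw [Function.comp_apply, prod_eq_prod_block_mul_prod_off (e := e)]
  simp only [splitFun_symm_apply_apply, splitFun_symm_apply_coe]

/-- The inner product factorises on pair product vectors: `⟨a ⊗ b|a' ⊗ b'⟩ = ⟨a|a'⟩⟨b|b'⟩`
(product index type). [cite: NielsenChuang2010, §2.1.7 eq. (2.49)] -/
theorem braket_pair {α β : Type*} [Fintype α] [Fintype β] (a a' : α → ℂ) (b b' : β → ℂ) :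
    braket (fun q : α × β => a q.1 * b q.2) (fun q => a' q.1 * b' q.2) = braket a a' * braket b b' := by
  unfold braket
  rw [Fintype.sum_prod_type, Finset.sum_mul_sum]
  refine Finset.sum_congr rfl fun p _ => Finset.sum_congr rfl fun r _ => ?_
  rw [map_mul]
  ring

/-- `(X ⊗ Y)(a ⊗ b) = Xa ⊗ Yb`. [cite: NielsenChuang2010, §2.1.7 eq. (2.45)] -/
theorem kronecker_mulVec_pair {α β : Type*} [Fintype α] [Fintype β] (X : Matrix α α ℂ)
    (Y : Matrix β β ℂ) (a : α → ℂ) (b : β → ℂ) :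
    (X ⊗ₖ Y) *ᵥ (fun q : α × β => a q.1 * b q.2) = fun q => (X *ᵥ a) q.1 * (Y *ᵥ b) q.2 := by
  funext q
  simp only [Matrix.mulVec, dotProduct, Matrix.kroneckerMap_apply]
  rw [Fintype.sum_prod_type, Finset.sum_mul_sum]
  refine Finset.sum_congr rfl fun p _ => Finset.sum_congr rfl fun r _ => ?_
  ring

/-- **Average value of a Kronecker product in a pair product state**:
`⟨a ⊗ b| X ⊗ Y |a ⊗ b⟩ = ⟨a|X|a⟩ · ⟨b|Y|b⟩`. [cite: NielsenChuang2010, §2.1.7 eqs. (2.45), (2.49)] -/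
theorem obsForm_kronecker_pair {α β : Type*} [Fintype α] [Fintype β] (X : Matrix α α ℂ)
    (Y : Matrix β β ℂ) (a : α → ℂ) (b : β → ℂ) :
    obsForm (X ⊗ₖ Y) (fun q : α × β => a q.1 * b q.2) (fun q => a q.1 * b q.2) =
      obsForm X a a * obsForm Y b b := by
  rw [obsForm, kronecker_mulVec_pair, braket_pair, obsForm, obsForm]

/-- **A gate placed OFF the block is `1 ⊗ Y₀` in block coordinates.** For `f` with range disjoint
from that of `e`, `placeGate f Y`, read through `splitFun e Bool`, is the Kronecker product of the
identity on the block with an operator `Y₀` of the remaining wires.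
[cite: NielsenChuang2010, §4.3 (a gate on a subset of the wires acts as U ⊗ 1)] -/
theorem exists_reindex_placeGate_eq_one_kronecker (e : Fin k ↪ Fin N) (f : Fin k' ↪ Fin N)
    (hef : Disjoint (Set.range e) (Set.range f)) (Y : Matrix (QReg k') (QReg k') ℂ) :
    ∃ Y₀ : Matrix (Off e → Bool) (Off e → Bool) ℂ,
      reindex (splitFun e Bool) (splitFun e Bool) (placeGate f Y) =
        (1 : Matrix (QReg k) (QReg k) ℂ) ⊗ₖ Y₀ := by
  -- every wire of `f` is off `e`
  have hf : ∀ j, f j ∈ (Set.range e)ᶜ := fun j he =>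
    Set.disjoint_left.1 hef he (Set.mem_range_self j)
  let f' : Fin k' → Off e := fun j => ⟨f j, hf j⟩
  refine ⟨Matrix.of fun r r' => if (∀ l : Off e, (l : Fin N) ∉ Set.range f → r l = r' l)
      then Y (r ∘ f') (r' ∘ f') else 0, ?_⟩
  ext ⟨p, r⟩ ⟨p', r'⟩
  rw [reindex_apply, submatrix_apply, placeGate_apply, kroneckerMap_apply, one_apply, Matrix.of_apply]
  have hxf : ((splitFun e Bool).symm (p, r)) ∘ f = r ∘ f' :=
    funext fun j => splitFun_symm_apply_coe p r ⟨f j, hf j⟩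
  have hyf : ((splitFun e Bool).symm (p', r')) ∘ f = r' ∘ f' :=
    funext fun j => splitFun_symm_apply_coe p' r' ⟨f j, hf j⟩
  rw [hxf, hyf]
  by_cases hp : p = p'
  · subst hp
    by_cases hr : ∀ l : Off e, (l : Fin N) ∉ Set.range f → r l = r' l
    · rw [if_pos hr, if_pos rfl, one_mul, if_pos]
      intro i hi
      by_cases hie : i ∈ Set.range e
      · obtain ⟨j, rfl⟩ := hie
        rw [splitFun_symm_apply_apply, splitFun_symm_apply_apply]
      · have h1 := splitFun_symm_apply_coe p r ⟨i, hie⟩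
        have h2 := splitFun_symm_apply_coe p r' ⟨i, hie⟩
        simp only at h1 h2
        rw [h1, h2]
        exact hr ⟨i, hie⟩ hi
    · rw [if_neg hr, if_pos rfl, one_mul, if_neg]
      intro h
      exact hr fun l hl => by
        have := h l hl
        rwa [splitFun_symm_apply_coe, splitFun_symm_apply_coe] at this
  · rw [if_neg hp, zero_mul, if_neg]
    intro h
    apply hp
    funext j
    have := h (e j) fun hj => Set.disjoint_left.1 hef (Set.mem_range_self j) hj
    rwa [splitFun_symm_apply_apply, splitFun_symm_apply_apply] at this


/-- Products of single-qubit unit vectors are unit vectors: `⟨⊗u|⊗u⟩ = ∏⟨u_l|u_l⟩ = 1`.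
[cite: NielsenChuang2010, §2.1.7 eq. (2.49)] -/
theorem braket_pi_self_eq_one {L : Type*} [Fintype L] [DecidableEq L] (u : L → Bool → ℂ)
    (hu : ∀ l, braket (u l) (u l) = 1) :
    braket (fun r : L → Bool => ∏ l, u l (r l)) (fun r => ∏ l, u l (r l)) = 1 := by
  rw [braket_pi_pi]
  exact Finset.prod_eq_one fun l _ => hu l

/-- The average value of the identity is the squared norm `⟨v|v⟩`. [cite: NielsenChuang2010, §2.2.5 eq. (2.113)] -/
theorem obsForm_one {α : Type*} [Fintype α] [DecidableEq α] (v : α → ℂ) :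
    obsForm (1 : Matrix α α ℂ) v v = braket v v := by
  rw [obsForm, Matrix.one_mulVec]

/-- Relabelling is multiplicative: `reindex σ σ (M N) = reindex σ σ M · reindex σ σ N`.
[cite: NielsenChuang2010, §2.1.7 eq. (2.50)] -/
theorem reindex_mul_reindex {α : Type*} [Fintype α] (σ : QReg N ≃ α) (M M' : Matrix (QReg N) (QReg N) ℂ) :
    reindex σ σ (M * M') = reindex σ σ M * reindex σ σ M' := by
  simp only [reindex_apply]
  exact (Matrix.submatrix_mul_equiv M M' σ.symm σ.symm σ.symm).symm

/-- **Disjointly placed observables factorise on products of single-qubit states**: for blocks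
`e`, `f` with disjoint wires and unit factors `u_w`,
`⟨(X ⊗ 1)(1 ⊗ Y)⟩_{⊗u} = ⟨X ⊗ 1⟩_{⊗u} · ⟨1 ⊗ Y⟩_{⊗u}` (in block coordinates the two operators are
`X ⊗ 1` and `1 ⊗ Y₀`, the state is `a ⊗ b`, and `⟨a⊗b|X⊗Y₀|a⊗b⟩ = ⟨a|X|a⟩⟨b|Y₀|b⟩`).
[cite: NielsenChuang2010, §2.1.7 eqs. (2.45), (2.49)] -/
theorem obsForm_placeGate_mul_placeGate_pi (e : Fin k ↪ Fin N) (f : Fin k' ↪ Fin N)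
    (hef : Disjoint (Set.range e) (Set.range f)) (X : Matrix (QReg k) (QReg k) ℂ)
    (Y : Matrix (QReg k') (QReg k') ℂ) (u : Fin N → Bool → ℂ) (hu : ∀ w, braket (u w) (u w) = 1) :
    obsForm (placeGate e X * placeGate f Y) (fun z => ∏ w, u w (z w)) (fun z => ∏ w, u w (z w)) =
      obsForm (placeGate e X) (fun z => ∏ w, u w (z w)) (fun z => ∏ w, u w (z w)) *
        obsForm (placeGate f Y) (fun z => ∏ w, u w (z w)) (fun z => ∏ w, u w (z w)) := by
  obtain ⟨Y₀, hY₀⟩ := exists_reindex_placeGate_eq_one_kronecker e f hef Y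
  have hπ := pi_comp_splitFun_symm e u
  have ha : braket (fun p : QReg k => ∏ j, u (e j) (p j)) (fun p => ∏ j, u (e j) (p j)) = 1 :=
    braket_pi_self_eq_one (fun j => u (e j)) fun j => hu (e j)
  have hb : braket (fun r : Off e → Bool => ∏ l : Off e, u l (r l)) (fun r => ∏ l : Off e, u l (r l)) = 1 :=
    braket_pi_self_eq_one (fun l : Off e => u l) fun l => hu l
  have k1 := obsForm_kronecker_pair X Y₀ (fun p : QReg k => ∏ j, u (e j) (p j))
    (fun r : Off e → Bool => ∏ l : Off e, u l (r l))
  have k2 := obsForm_kronecker_pair X (1 : Matrix (Off e → Bool) (Off e → Bool) ℂ)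
    (fun p : QReg k => ∏ j, u (e j) (p j)) (fun r : Off e → Bool => ∏ l : Off e, u l (r l))
  have k3 := obsForm_kronecker_pair (1 : Matrix (QReg k) (QReg k) ℂ) Y₀
    (fun p : QReg k => ∏ j, u (e j) (p j)) (fun r : Off e → Bool => ∏ l : Off e, u l (r l))
  rw [← obsForm_reindex (splitFun e Bool) (placeGate e X * placeGate f Y),
    ← obsForm_reindex (splitFun e Bool) (placeGate e X),
    ← obsForm_reindex (splitFun e Bool) (placeGate f Y), reindex_mul_reindex, reindex_placeGate,
    hY₀, ← Matrix.mul_kronecker_mul, Matrix.mul_one, Matrix.one_mul, hπ, k1, k2, k3, obsForm_one,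
    obsForm_one, ha, hb, mul_one, one_mul]

/-- Over a unitary gate set the Heisenberg picture is multiplicative:
`U†(O O')U = (U† O U)(U† O' U)`. [cite: BravyiGossetMovassagh2021, §2 Definition 1] -/
theorem heis_mul (hG : G.IsUnitary) (A : Language Bool) (gs : List (QGate G N))
    (O O' : Matrix (QReg N) (QReg N) ℂ) :
    heis A gs (O * O') = heis A gs O * heis A gs O' := by
  have hU := QCircuit.toMatrix_mem_unitaryGroup_holds hG A (⟨gs⟩ : QCircuit G N)
  have h1 : (⟨gs⟩ : QCircuit G N).toMatrix A * ((⟨gs⟩ : QCircuit G N).toMatrix A)ᴴ = 1 := by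
    rw [← star_eq_conjTranspose]; exact Matrix.mem_unitaryGroup_iff.1 hU
  simp only [heis, Matrix.mul_assoc]
  rw [← Matrix.mul_assoc ((⟨gs⟩ : QCircuit G N).toMatrix A) (((⟨gs⟩ : QCircuit G N).toMatrix A)ᴴ), h1,
    Matrix.one_mul]

/-- The Heisenberg picture of `O' ⊗ 1` through gates transported along the block `e` is
`(U'† O' U') ⊗ 1`. [cite: NielsenChuang2010, §2.1.7 eqs. (2.45), (2.53)] -/
theorem heis_map_mapWiresGate (A : Language Bool) (e : Fin k ↪ Fin N) (gs' : List (QGate G k))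
    (O' : Matrix (QReg k) (QReg k) ℂ) :
    heis A (gs'.map (mapWiresGate e)) (placeGate e O') = placeGate e (heis A gs' O') := by
  have hm : (⟨gs'.map (mapWiresGate e)⟩ : QCircuit G N).toMatrix A =
      placeGate e ((⟨gs'⟩ : QCircuit G k).toMatrix A) := toMatrix_mapWires e A ⟨gs'⟩
  rw [heis, heis, hm, conjTranspose_placeGate, ← placeGate_mul_holds, ← placeGate_mul_holds]

/-- **Observables with disjoint light cones factorise.** Over a unitary gate set, on a product of
single-qubit unit vectors: if `O₁ ⊗ 1` (placed along the block `e₁`, supported on `S₁`) and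
`O₂ ⊗ 1` (block `e₂`, supported on `S₂`) have backward light cones that are transports of gate
lists on the blocks `e₁`, `e₂`, and the two blocks are DISJOINT, then the average value of the
product after the circuit is the product of the average values — “Since the lightcones of `S₁`
and `S₂` do not overlap, `μ_S(ε)` is a product” of a factor depending on `S₁` and one depending on
`S₂`. [cite: BravyiGossetMovassagh2021, §3 (proof of Lemma 3)] -/
theorem obsForm_toMatrix_mul_eq_mul_of_disjoint (hG : G.IsUnitary) (A : Language Bool)
    {S₁ S₂ : Finset (Fin N)} (e₁ : Fin k ↪ Fin N) (e₂ : Fin k' ↪ Fin N)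
    (h12 : Disjoint (Set.range e₁) (Set.range e₂)) (O₁ : Matrix (QReg k) (QReg k) ℂ)
    (O₂ : Matrix (QReg k') (QReg k') ℂ) (hO₁ : SupportedOn S₁ (placeGate e₁ O₁))
    (hO₂ : SupportedOn S₂ (placeGate e₂ O₂)) (gs : List (QGate G N)) (gs₁ : List (QGate G k))
    (gs₂ : List (QGate G k')) (hc₁ : (cone gs S₁).2 = gs₁.map (mapWiresGate e₁))
    (hc₂ : (cone gs S₂).2 = gs₂.map (mapWiresGate e₂)) (u : Fin N → Bool → ℂ)
    (hu : ∀ w, braket (u w) (u w) = 1) :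
    obsForm (placeGate e₁ O₁ * placeGate e₂ O₂)
        ((⟨gs⟩ : QCircuit G N).toMatrix A *ᵥ fun z => ∏ w, u w (z w))
        ((⟨gs⟩ : QCircuit G N).toMatrix A *ᵥ fun z => ∏ w, u w (z w)) =
      obsForm (placeGate e₁ O₁) ((⟨gs⟩ : QCircuit G N).toMatrix A *ᵥ fun z => ∏ w, u w (z w))
          ((⟨gs⟩ : QCircuit G N).toMatrix A *ᵥ fun z => ∏ w, u w (z w)) *
        obsForm (placeGate e₂ O₂) ((⟨gs⟩ : QCircuit G N).toMatrix A *ᵥ fun z => ∏ w, u w (z w))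
          ((⟨gs⟩ : QCircuit G N).toMatrix A *ᵥ fun z => ∏ w, u w (z w)) := by
  rw [obsForm_toMatrix_mulVec, obsForm_toMatrix_mulVec, obsForm_toMatrix_mulVec, heis_mul hG,
    heis_eq_heis_cone hG A hO₁ gs, heis_eq_heis_cone hG A hO₂ gs, hc₁, hc₂, heis_map_mapWiresGate,
    heis_map_mapWiresGate]
  exact obsForm_placeGate_mul_placeGate_pi e₁ e₂ h12 _ _ u hu

end Factorise

end LightCone

end Literature.Computability.QuantumComplexity

end
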